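import Mathlib.LinearAlgebra.BilinearForm.Orthogonal
import Literature.AlgebraicGeometry.Motives.HodgeStructureK3TypeAdjointProofs
import HarnessLib

/-!
# Sub-Hodge structures: Hodge components, kernels, and nondegeneracy of polarisations

Layer `Literature/AlgebraicGeometry/Motives`; companion of `HodgeStructure` (pure `ℚ`-Hodge
structures in filtration form, `SubHodgeStructure`, `Hom`, `Polarization`), `HodgeStructureProofs`
(the Hodge decomposition `V_ℂ = ⊕ V^{p,n-p}`: `iSupIndep_piece_holds`, `iSup_piece_eq_top_holds`),
`HodgeStructureWeil` (`Hom.map_piece_le`, `Polarization.form_piece_piece`) and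
`HodgeStructureK3TypeAdjointProofs` (generic tools reused here: `baseChange_injective_of_injective`,
`ofRat_injective`, `disjoint_piece_biSup`, `Hom.baseChange_mem_biSup_piece`,
`Polarization.form_swap`, `Polarization.form_baseChange_swap`). Everything here is PROVED; no
named fact is introduced. This file carries the two ingredients of the printed proof of
the semisimplicity of polarisable Hodge structures (C. Voisin, *Hodge and generalized Hodge
conjectures, coniveau and algebraic cycles*, J. Open Math. Probl. 1 (2025), Prop. 2.11, verbatim:
"This is done by proving that the pairing `q` giving a polarization on `H` remains nondegenerate
on `H′`, which allows to set `H″ := H′^{⊥q}`. The nondegeneracy of `q|H′` is proved using the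
Hodge-Riemann bilinear relations"; = C. Voisin, *Hodge Theory and Complex Algebraic Geometry I*
(2002), Lemma 7.26), whose conclusion is drawn in `HodgeStructureSemisimple`:

* `SubHodgeStructure.baseChange_le_iSup_inf` — a sub-Hodge structure is the sum of its
  intersections with the Hodge pieces, `W_ℂ ⊆ Σ_p (W_ℂ ∩ V^{p,n-p})` (Voisin I, §7.3.1,
  Def. 7.24: a sub-Hodge structure is a `W_ℚ` with `W_ℂ = ⊕ W_ℂ ∩ V^{p,q}`); conversely
  `SubHodgeStructure.exists_eq_of_baseChange_le`: a `ℚ`-subspace with this property underlies a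
  sub-Hodge structure in the tree's (opposed-filtrations) sense.
* `Hom.exists_subHodgeStructure_ker` — the kernel of a morphism of Hodge structures is a
  sub-Hodge structure (Voisin I, §7.3.1; the pieces being independent).
* `Polarization.isRefl`, `Polarization.isRefl_baseChange` — a polarisation and its
  complexification are reflexive bilinear forms (`(-1)ⁿ`-symmetry, `Polarization.form_swap`).
* `Polarization.eq_zero_of_forall_mem_baseChange`, `Polarization.disjoint_orthogonal` — **a
  polarisation is nondegenerate on every sub-Hodge structure**: `W ∩ W^{⊥Q} = 0`, by the two
  Hodge–Riemann relations.

Generic lemma over `ℚ ⊆ ℂ` (`ℂ` is flat over `ℚ`): base change commutes with kernels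
(`mem_baseChange_ker_iff`). No finite-dimensionality is assumed in this file.

## References

* [Voisin2025] C. Voisin, Hodge and generalized Hodge conjectures, coniveau and algebraic cycles,
  J. Open Math. Probl. 1 (2025) 16–51, Prop. 2.11 (proof).
* [VoisinHodgeI2002] C. Voisin, Hodge Theory and Complex Algebraic Geometry I, CUP 2002, §7.1.2
  Def. 7.7, §7.3.1 Def. 7.24, Lemma 7.26.
* [DeligneHodgeII1971] P. Deligne, Théorie de Hodge II, Publ. Math. IHÉS 40 (1971), 1.2.5, 2.1.
-/

open scoped TensorProduct

noncomputable section

namespace Literature.AlgebraicGeometry.Motives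

namespace HodgeStructure

universe u v

variable {V : Type u} [AddCommGroup V] [Module ℚ V]
variable {V' : Type v} [AddCommGroup V'] [Module ℚ V']
variable {n : ℤ}


/-! ### Base change and kernels -/

/-- The kernel of the base change is the base change of the kernel (`ℂ` flat over `ℚ`):
`x ∈ (ker f)_ℂ ↔ f_ℂ x = 0`. [folklore] -/
theorem mem_baseChange_ker_iff (f : V' →ₗ[ℚ] V) (x : ℂ ⊗[ℚ] V') :
    x ∈ (LinearMap.ker f).baseChange ℂ ↔ f.baseChange ℂ x = 0 := by
  have hex := Module.Flat.lTensor_exact ℂ (LinearMap.exact_subtype_ker_map f) x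
  rw [← LinearMap.baseChange_eq_ltensor, ← LinearMap.baseChange_eq_ltensor] at hex
  exact hex.symm

/-! ### Sub-Hodge structures and the Hodge decomposition -/

/-- The Hodge filtration of the induced Hodge structure of a sub-Hodge structure is the pull-back
of `F`. [folklore] -/
theorem SubHodgeStructure.toHodgeStructure_F {H : HodgeStructure V n} (S : SubHodgeStructure H)
    (p : ℤ) : S.toHodgeStructure.F p = (H.F p).comap (S.toSubmodule.subtype.baseChange ℂ) := rfl

/-- **A sub-Hodge structure is the sum of its intersections with the Hodge pieces**:
`W_ℂ ⊆ Σ_p (W_ℂ ∩ V^{p,n-p})` (the Hodge decomposition of the induced structure, pushed forward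
along `W_ℂ ↪ V_ℂ`; Voisin I, §7.3.1, Def. 7.24: "`W_ℂ = ⊕ W_ℂ ∩ V^{p,q}`").
[cite: VoisinHodgeI2002, §7.3.1 Def. 7.24] -/
theorem SubHodgeStructure.baseChange_le_iSup_inf {H : HodgeStructure V n}
    (S : SubHodgeStructure H) :
    S.toSubmodule.baseChange ℂ ≤ ⨆ p : ℤ, S.toSubmodule.baseChange ℂ ⊓ H.piece p (n - p) := by
  set ι := S.toSubmodule.subtype.baseChange ℂ with hι
  have htop := iSup_piece_eq_top_holds S.toHodgeStructure
  rintro x ⟨w, rfl⟩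
  have hw : w ∈ ⨆ p : ℤ, S.toHodgeStructure.piece p (n - p) := by
    rw [htop]
    exact Submodule.mem_top
  have hmap : (⨆ p : ℤ, S.toHodgeStructure.piece p (n - p)).map ι ≤
      ⨆ p : ℤ, S.toSubmodule.baseChange ℂ ⊓ H.piece p (n - p) := by
    rw [Submodule.map_iSup]
    refine iSup_mono fun p ↦ ?_
    rintro _ ⟨y, hy, rfl⟩
    rw [SetLike.mem_coe, S.toHodgeStructure.mem_piece_iff (show p + (n - p) = n by ring),
      toHodgeStructure_F, toHodgeStructure_F, Submodule.mem_comap, Submodule.mem_comap] at hy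
    refine ⟨⟨y, rfl⟩, ?_⟩
    rw [SetLike.mem_coe, H.mem_piece_iff (show p + (n - p) = n by ring), conj_baseChange]
    exact hy
  exact hmap ⟨w, hw, rfl⟩

/-- **Constructor for sub-Hodge structures**: a `ℚ`-subspace `W` such that
`W_ℂ ⊆ Σ_p (W_ℂ ∩ V^{p,n-p})` underlies a sub-Hodge structure — the induced filtration and its
conjugate are `n`-opposed: for `p + q = n + 1` every `w ∈ W_ℂ` is the sum of its components of
type `(i, n-i)`, `i ≥ p` (in `F^p`) and of those with `i < p` (in `conj F^q`)
(Voisin I, §7.3.1, Def. 7.24). [cite: VoisinHodgeI2002, §7.3.1 Def. 7.24] -/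
theorem SubHodgeStructure.exists_eq_of_baseChange_le {H : HodgeStructure V n} (W : Submodule ℚ V)
    (hW : W.baseChange ℂ ≤ ⨆ p : ℤ, W.baseChange ℂ ⊓ H.piece p (n - p)) :
    ∃ S : SubHodgeStructure H, S.toSubmodule = W := by
  set ι := W.subtype.baseChange ℂ with hι
  have hinj : Function.Injective ι := baseChange_injective_of_injective W.injective_subtype
  refine ⟨⟨W, fun p q hpq ↦ ⟨?_, ?_⟩⟩, rfl⟩
  · rw [disjoint_iff, ← Submodule.comap_inf, (H.isCompl_F_complexConj p q hpq).inf_eq_bot,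
      Submodule.comap_bot, LinearMap.ker_eq_bot.2 hinj]
  · rw [codisjoint_iff, eq_top_iff]
    rintro w -
    have hx : ι w ∈ ⨆ p : ℤ, W.baseChange ℂ ⊓ H.piece p (n - p) := hW ⟨w, rfl⟩
    suffices h : ∃ a ∈ W.baseChange ℂ ⊓ H.F p, ∃ b ∈ W.baseChange ℂ ⊓ complexConj (H.F q),
        ι w = a + b by
      obtain ⟨a, ⟨⟨a', rfl⟩, ha⟩, b, ⟨⟨b', rfl⟩, hb⟩, hab⟩ := h
      rw [← map_add] at hab
      rw [hinj hab]
      exact Submodule.add_mem_sup ha hb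
    generalize ι w = x at hx ⊢
    induction hx using Submodule.iSup_induction' with
    | mem i x hx =>
      obtain ⟨hxW, hxi⟩ := hx
      by_cases hip : p ≤ i
      · exact ⟨x, ⟨hxW, H.antitone_F hip (piece_le_F H i (n - i) hxi)⟩, 0,
          Submodule.zero_mem _, (add_zero x).symm⟩
      · refine ⟨0, Submodule.zero_mem _, x, ⟨hxW, ?_⟩, (zero_add x).symm⟩
        exact complexConj_mono (H.antitone_F (show q ≤ n - i by omega))
          (piece_le_complexConj_F H i (n - i) hxi)
    | zero => exact ⟨0, Submodule.zero_mem _, 0, Submodule.zero_mem _, (add_zero _).symm⟩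
    | add x y _ _ hx hy =>
      obtain ⟨a, ha, b, hb, rfl⟩ := hx
      obtain ⟨a', ha', b', hb', rfl⟩ := hy
      exact ⟨a + a', Submodule.add_mem _ ha ha', b + b', Submodule.add_mem _ hb hb', by abel⟩

/-- **The kernel of a morphism of Hodge structures is a sub-Hodge structure** (Voisin I,
§7.3.1; Deligne, Hodge II, 2.1.6–2.3.5): `(ker φ)_ℂ = ker φ_ℂ` (flatness), and if
`x = Σ xᵢ ∈ ker φ_ℂ` with `xᵢ ∈ V'^{i,n-i}` then `φ_ℂ xᵢ ∈ V^{i,n-i}` sum to `0`, hence vanish by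
the independence of the pieces, i.e. every `xᵢ ∈ ker φ_ℂ`. [cite: VoisinHodgeI2002, §7.3.1] -/
theorem Hom.exists_subHodgeStructure_ker {H' : HodgeStructure V' n} {H : HodgeStructure V n}
    (φ : Hom H' H) :
    ∃ S : SubHodgeStructure H', S.toSubmodule = LinearMap.ker φ.toLinearMap := by
  refine SubHodgeStructure.exists_eq_of_baseChange_le _ ?_
  set K := LinearMap.ker φ.toLinearMap with hK
  set φc := φ.toLinearMap.baseChange ℂ with hφc
  intro x hx
  have hx0 : φc x = 0 := (mem_baseChange_ker_iff φ.toLinearMap x).1 hx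
  have hxtop : x ∈ ⨆ p : ℤ, H'.piece p (n - p) := by
    rw [iSup_piece_eq_top_holds H']
    exact Submodule.mem_top
  obtain ⟨s, hs⟩ := Submodule.mem_iSup_iff_exists_finset.1 hxtop
  clear hx hxtop
  induction s using Finset.induction_on generalizing x with
  | empty =>
    simp only [Finset.notMem_empty, not_false_eq_true, iSup_neg, iSup_bot,
      Submodule.mem_bot] at hs
    rw [hs]
    exact Submodule.zero_mem _
  | insert a s ha ih =>
    rw [Finset.iSup_insert, Submodule.mem_sup] at hs
    obtain ⟨z, hz, w, hw, rfl⟩ := hs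
    have hφz : φc z ∈ H.piece a (n - a) := φ.map_piece_le a (n - a) ⟨z, hz, rfl⟩
    have hφw : φc w ∈ ⨆ i ∈ s, H.piece i (n - i) := φ.baseChange_mem_biSup_piece hw
    have hz0 : φc z = 0 := by
      refine (Submodule.disjoint_def.1 (disjoint_piece_biSup H ha)) _ hφz ?_
      have hzw : φc z = -φc w := by
        rw [map_add] at hx0
        exact eq_neg_of_add_eq_zero_left hx0
      rw [hzw]
      exact Submodule.neg_mem _ hφw
    have hw0 : φc w = 0 := by rwa [map_add, hz0, zero_add] at hx0
    refine Submodule.add_mem _ (Submodule.mem_iSup_of_mem a ⟨?_, hz⟩) (ih hw0 hw)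
    exact (mem_baseChange_ker_iff φ.toLinearMap z).2 hz0

/-! ### Polarisations: symmetry and nondegeneracy on sub-Hodge structures -/

/-- A polarisation form is reflexive. [folklore] -/
theorem Polarization.isRefl {H : HodgeStructure V n} (Q : Polarization H) : Q.form.IsRefl :=
  fun x y h ↦ by rw [Q.form_swap, h, mul_zero]

/-- The complexified polarisation form is reflexive. [folklore] -/
theorem Polarization.isRefl_baseChange {H : HodgeStructure V n} (Q : Polarization H) :
    (Q.form.baseChange ℂ).IsRefl :=
  fun x y h ↦ by rw [Q.form_baseChange_swap, h, mul_zero]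

/-- First Hodge–Riemann relation against a finite sum of pieces: `Q_ℂ(x, w) = 0` for
`x ∈ V^{p,n-p}` and `w ∈ Σ_{i ∈ s} (Tᵢ ∩ V^{i,n-i})` as soon as `p + i ≠ n` on `s`.
[cite: VoisinHodgeI2002, §7.1.2 Def. 7.7] -/
theorem Polarization.form_eq_zero_of_mem_biSup_inf {H : HodgeStructure V n} (Q : Polarization H)
    {p : ℤ} {s : Finset ℤ} (hs : ∀ i ∈ s, p + i ≠ n) {T : ℤ → Submodule ℂ (ℂ ⊗[ℚ] V)}
    {x w : ℂ ⊗[ℚ] V} (hx : x ∈ H.piece p (n - p))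
    (hw : w ∈ ⨆ i ∈ s, T i ⊓ H.piece i (n - i)) : Q.form.baseChange ℂ x w = 0 := by
  induction hw using Submodule.iSup_induction' with
  | mem i y hy =>
    by_cases his : i ∈ s
    · rw [iSup_pos his] at hy
      exact Q.form_piece_piece (hs i his) hx hy.2
    · rw [iSup_neg his, Submodule.mem_bot] at hy
      rw [hy, map_zero]
  | zero => rw [map_zero]
  | add y₁ y₂ _ _ h₁ h₂ => rw [map_add, h₁, h₂, add_zero]

/-- **A polarisation is nondegenerate on every sub-Hodge structure** (complexified form): if
`m ∈ W_ℂ` is `Q_ℂ`-orthogonal to `W_ℂ` then `m = 0`. Write `m = Σ mᵢ`, `mᵢ ∈ W_ℂ ∩ V^{i,n-i}`;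
`conj mᵢ ∈ W_ℂ`, and `Q_ℂ(conj mᵢ, m) = Q_ℂ(conj mᵢ, mᵢ)` by the first Hodge–Riemann relation, so
the second one forces `mᵢ = 0` (Voisin 2025, proof of Prop. 2.11: "the nondegeneracy of `q|H′`
is proved using the Hodge–Riemann bilinear relations"; Voisin I, Lemma 7.26).
[cite: Voisin2025, Prop. 2.11 (proof)] [cite: VoisinHodgeI2002, Lemma 7.26] -/
theorem Polarization.eq_zero_of_forall_mem_baseChange {H : HodgeStructure V n}
    (Q : Polarization H) (S : SubHodgeStructure H) {m : ℂ ⊗[ℚ] V}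
    (hm : m ∈ S.toSubmodule.baseChange ℂ)
    (h0 : ∀ x ∈ S.toSubmodule.baseChange ℂ, Q.form.baseChange ℂ x m = 0) : m = 0 := by
  obtain ⟨s, hs⟩ := Submodule.mem_iSup_iff_exists_finset.1 (S.baseChange_le_iSup_inf hm)
  clear hm
  induction s using Finset.induction_on generalizing m with
  | empty =>
    simpa only [Finset.notMem_empty, not_false_eq_true, iSup_neg, iSup_bot,
      Submodule.mem_bot] using hs
  | insert a s ha ih =>
    rw [Finset.iSup_insert, Submodule.mem_sup] at hs
    obtain ⟨z, ⟨hzW, hz⟩, w, hw, rfl⟩ := hs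
    have hcz : conj z ∈ S.toSubmodule.baseChange ℂ := by
      obtain ⟨z', rfl⟩ := hzW
      exact ⟨conj z', (conj_baseChange _ _).symm⟩
    have hczp : conj z ∈ H.piece (n - a) (n - (n - a)) := by
      rw [sub_sub_cancel]
      exact conj_mem_piece H hz
    have hQw : Q.form.baseChange ℂ (conj z) w = 0 :=
      Q.form_eq_zero_of_mem_biSup_inf (fun i hi h ↦ ha (by rwa [show i = a by omega] at hi))
        hczp hw
    have hQz : Q.form.baseChange ℂ z (conj z) = 0 := by
      have h1 := h0 (conj z) hcz
      rw [map_add, hQw, add_zero] at h1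
      have h2 := form_baseChange_conj Q.form z (conj z)
      rw [conj_conj, h1] at h2
      exact (star_eq_zero.1 h2.symm)
    have hz0 : z = 0 := by
      by_contra hz0
      obtain ⟨r, hr, hQ⟩ := Q.pos a (n - a) (by ring) z hz hz0
      rw [hQz, mul_zero] at hQ
      exact hr.ne' (by exact_mod_cast hQ.symm)
    subst hz0
    rw [zero_add] at h0 ⊢
    exact ih (fun x hx ↦ h0 x hx) hw

/-- **`W ∩ W^{⊥Q} = 0`** for a sub-Hodge structure `W` of a polarised Hodge structure: the
restriction of `Q` to `W` is nondegenerate (Voisin 2025, proof of Prop. 2.11; Voisin I,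
Lemma 7.26). [cite: Voisin2025, Prop. 2.11 (proof)] [cite: VoisinHodgeI2002, Lemma 7.26] -/
theorem Polarization.disjoint_orthogonal {H : HodgeStructure V n} (Q : Polarization H)
    (S : SubHodgeStructure H) : Disjoint S.toSubmodule (Q.form.orthogonal S.toSubmodule) := by
  rw [Submodule.disjoint_def]
  intro x hx hx'
  rw [LinearMap.BilinForm.mem_orthogonal_iff] at hx'
  have h := Q.eq_zero_of_forall_mem_baseChange S (m := ofRat x)
    (by rw [ofRat_apply]; exact Submodule.tmul_mem_baseChange_of_mem 1 hx) ?_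
  · exact ofRat_injective (by rw [h, map_zero])
  · rintro _ ⟨t, rfl⟩
    induction t using TensorProduct.induction_on with
    | zero => simp
    | tmul c w =>
      rw [LinearMap.baseChange_tmul, ofRat_apply, LinearMap.BilinForm.baseChange_tmul,
        Submodule.subtype_apply, hx' w w.2, zero_smul]
    | add t₁ t₂ h₁ h₂ => rw [map_add, map_add, LinearMap.add_apply, h₁, h₂, add_zero]

end HodgeStructure

end Literature.AlgebraicGeometry.Motives

end
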